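import Literature.MathematicalPhysics.QuantumFieldTheory.Balaban1983to89.T4HaarSU2ExpChart
import Literature.MathematicalPhysics.QuantumFieldTheory.Balaban1983to89.B10Eq22Rescaling

/-!
# `Summit.QuantumFields.Balaban3D.Proofs.ChartSU2` — [Balaban1985UV3] p. 260, the chart change of variables of **(13)→(18)** «we
# express the Haar measure dU′ as dU′ = σ(A′)dA′ … e.g. for G = SU(2) we have σ(A) = (2π²)⁻¹ (sin|A|/|A|)²» FOR G = SU(2), with
# print's σ AS TYPED in LQB (`B10Eq22Rescaling.sigmaSU2`): LQB's exponential-chart theorem for SU(2) (`T4HaarSU2ExpChart`) IS this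
# change of variables, and its weight `expWeight` IS print's `σ` — lane `pub-balaban3d`, seat p4 (ruling R-DISP: «(51)/(16) chart
# change of variables with Jacobian σ ← p4»)

HONEST FRAMING (lane PLAN.md §0, binding): see `…Proofs.SectAFirstStep`.  G = SU(2) only (the printed example; the general-G density
σ is p1's Group carrier, PLAN §3.1); nothing else of [Balaban1985UV3] is touched.

WHAT IS PRINTED.  p. 260 L18–24 (render p006, running head excluded): «To write the integrals (13) in terms of the variables A′ we express the Haar
measure dU′ as dU′ = σ(A′)dA′ = σ₀ σ/σ₀ (A′)dA′, σ₀ = σ(0), where dA′ is the Lebesque measure on 𝔤, and σ(A′) is a density which can be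
calculated explicitly for all classical groups. e.g. for G = SU(2) we have σ(A) = (2π²)^{−1} (sin|A|/|A|)². Generally σ(A) is an
analytic, positive, even function of A in a neighbourhood of 0∈𝔤».

WHAT LQB ALREADY HAS (RE-USED BY NAME): `B10Eq22Rescaling.sigmaSU2 r := 1/(2π²)·(if r = 0 then 1 else sin r/r)²` (print's formula,
«transcribed, not derived from the Haar measure» — its docstring), `sigmaSU2_zero` (σ₀ = 1/(2π²)); `T4HaarSU2ExpChart.expPoint x =
exp(ι x) ∈ SU(2)` (x ∈ ℝ³ ≅ 𝔰𝔲(2)), `expWeight x = (2π²)⁻¹ sinc²‖x‖`, `map_expPoint_expMeasure` (push-forward of `expWeight·1_{‖x‖<π}d³x`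
under `expPoint` = Haar probability on SU(2)) and its Bochner form `integral_haarProbability_su2_exp`.

WHAT THIS FILE PROVES (no `sorry`, axioms standard; theorems only, LQB-only imports):
* `expWeight_eq_sigmaSU2` — LQB's chart weight IS print's σ: `expWeight x = sigmaSU2 ‖x‖` (so the «transcribed, not derived» formula of
  `B10Eq22Rescaling` is now DERIVED from the Haar measure of SU(2), via `T4HaarSU2ExpChart`);
* `integral_haar_su2_eq_integral_sigma` — **«dU′ = σ(A′)dA′» for SU(2)**: for every Haar-a.e.-strongly-measurable `f : SU(2) → F`,
  `∫ f(U′) dU′ = ∫_{|A′|<π} σ(|A′|)·f(exp(iA′)) d³A′`;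
* `sigma0_su2` — `σ₀ = σ(0) = expWeight 0 = 1/(2π²)`.
-/

namespace Summit.QuantumFields.Balaban3D.Proofs.ChartSU2

open MeasureTheory Metric
open Literature.MathematicalPhysics.QuantumFieldTheory (haarProbability)
open Literature.MathematicalPhysics.QuantumFieldTheory.Balaban1983to89
open Literature.MathematicalPhysics.QuantumFieldTheory.Balaban1983to89.T4HaarSU2ExpChart (expPoint expWeight)
open Literature.MathematicalPhysics.QuantumFieldTheory.Balaban1983to89.B10Eq22Rescaling (sigmaSU2)

/-- **LQB's exponential-chart weight of SU(2) IS print's σ** (p. 260 L21 «for G = SU(2) we have σ(A) = (2π²)^{−1} (sin|A|/|A|)²»):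
`expWeight x = sigmaSU2 ‖x‖` — `(2π²)⁻¹ sinc²‖x‖` against `1/(2π²)·(sin r/r)²` with the removable singularity filled the same way.
[cite: Balaban1985UV3, p.260 (before (18))] -/
theorem expWeight_eq_sigmaSU2 (x : EuclideanSpace ℝ (Fin 3)) : expWeight x = sigmaSU2 ‖x‖ := by
  unfold expWeight sigmaSU2 Real.sinc
  rw [one_div]

/-- **«dU′ = σ(A′)dA′» for G = SU(2)** (p. 260 L18–21), kernel-checked: for every `f : SU(2) → F` a.e.-strongly measurable for the
Haar probability measure, `∫ f(U′) dU′ = ∫_{|A′|<π} σ(|A′|)·f(exp(iA′)) d³A′` with print's σ (`sigmaSU2`) and `exp(iA′)` = LQB's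
`expPoint A′` (the chart covers SU(2) up to a null set; `|A′| < π` = injectivity ball).  LQB `integral_haarProbability_su2_exp` +
`expWeight_eq_sigmaSU2`. [cite: Balaban1985UV3, (18) p.260] -/
theorem integral_haar_su2_eq_integral_sigma {F : Type*} [NormedAddCommGroup F] [NormedSpace ℝ F]
    (f : Matrix.specialUnitaryGroup (Fin 2) ℂ → F)
    (hf : AEStronglyMeasurable f (haarProbability (Matrix.specialUnitaryGroup (Fin 2) ℂ))) :
    ∫ U, f U ∂(haarProbability (Matrix.specialUnitaryGroup (Fin 2) ℂ)) =
      ∫ x in ball (0 : EuclideanSpace ℝ (Fin 3)) Real.pi, sigmaSU2 ‖x‖ • f (expPoint x) := by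
  rw [T4HaarSU2ExpChart.integral_haarProbability_su2_exp f hf]
  refine integral_congr_ae (Filter.Eventually.of_forall fun x => ?_)
  simp only [expWeight_eq_sigmaSU2]

/-- `σ₀ = σ(0) = 1/(2π²)` (p. 260 L19 «σ₀ = σ(0)»): the chart weight at the origin. [cite: Balaban1985UV3, p.260 (before (18))] -/
theorem sigma0_su2 : expWeight 0 = 1 / (2 * Real.pi ^ 2) := by
  rw [expWeight_eq_sigmaSU2, norm_zero, B10Eq22Rescaling.sigmaSU2_zero]

end Summit.QuantumFields.Balaban3D.Proofs.ChartSU2
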